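import Summits.HodgeConjecture.HodgeConjecture.Theorems.NikulinTwinTransportTwinTwistorTransportTwistorReachAlgebra
import Summits.HodgeConjecture.HodgeConjecture.Theorems.NikulinTwinTransportTwinTwistorTransportTwistorReachLattice

/-!
# Crux `NikulinTwinTransport.TwinTwistorTransport` (stmt-HodgeConjecture-14393), line
# `mukai-lift-full-similitude`, stub `TwistorReach` — part B2: the chain of three generic twistor
# lines and Huybrechts Ch. 7 Prop. 3.2 for an arbitrary non-degenerate integral lattice

Continuation of `…TwistorReachLattice` (part B: forms, period points, generic vectors of the
integral lattice `ℤ^ι` with Gram matrix `G`) using the bilinear algebra of `…TwistorReachAlgebra`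
(part A, `twistorV_*`). Here: positive / generic three-spaces from positive triples and generic
vectors, the existence of ONE generic positive three-space (`exists_lattice_generic_posFamily`),
Beauville's chain of three generic twistor lines from any period point into a fixed twistor
line (`exists_lattice_twistorChain_to`), and the connectivity theorem
`lattice_periodDomain_twistorConnected` = Huybrechts, *Lectures on K3 Surfaces*, Ch. 7
Prop. 3.2 ("Any two points `x, y ∈ D` are equivalent") for every symmetric integral Gram matrix
with `det G ≠ 0` and a positive triple (only `n₊ ≥ 3` is used). Shapes of period points,
three-spaces, twistor lines and the elementary step are spelled out by local notations, symbol
for symbol those of `K3TwistorLines` with `k3Gram` replaced by `G`. Registered sub-goal (crux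
item stmt-HodgeConjecture-14393): `latticeTwistorConnected`. Part C (`…TwistorReach`)
transports it to the Mukai-lift lattice `Λ_{K3} ⊕ ⟨−2⟩`.

References: [Huybrechts2016K3] Ch. 6 Prop. 1.5; Ch. 7 §3.1 Def. 3.1, Prop. 3.2 (after
Beauville, Astérisque 126 (1985) Exp. VIII).
-/

-- `Summit.HodgeConjecture.HodgeConjecture.…` (summit = problem) duplicates a namespace component by design (D-0017).
set_option linter.dupNamespace false

noncomputable section

namespace Summit.HodgeConjecture.HodgeConjecture.Theorems.TwinTwistorTransport.MukaiLift

open scoped BigOperators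

variable {ι : Type} [Fintype ι] [DecidableEq ι]

/-- The complex bilinear form `(a.b) = Σᵢⱼ aᵢ Gᵢⱼ bⱼ` of the Gram matrix `G` on `Λ_ℂ = ι → ℂ`. -/
local notation3 (prettyPrint := false) "CF[" G "](" a ", " b ")" =>
  ∑ i, ∑ j, (a : _ → ℂ) i * (((G : Matrix _ _ ℤ) i j : ℤ) : ℂ) * (b : _ → ℂ) j

/-- The real bilinear form of `G` on `Λ_ℝ = ι → ℝ` (Mathlib's `Matrix.toBilin'`). -/
local notation3 (prettyPrint := false) "RB[" G "]" =>
  Matrix.toBilin' (Matrix.map (G : Matrix _ _ ℤ) (Int.cast : ℤ → ℝ))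

/-! ### Positive and generic three-spaces in terms of the real form -/

/-- `PosThree[G] W`: `W ⊂ Λ_ℝ` is a positive three-space (dimension `3`, the complex form has
positive real part on the non-zero real vectors of `W`) — the shape of `IsPositiveThreeSpace`. -/
local notation3 (prettyPrint := false) "PosThree[" G "](" W ")" =>
  (Module.finrank ℝ (W : Submodule ℝ (_ → ℝ)) = 3 ∧
    ∀ w ∈ (W : Submodule ℝ (_ → ℝ)), w ≠ 0 →
      0 < (∑ i, ∑ j, (fun i => ((w : _ → ℝ) i : ℂ)) i * (((G : Matrix _ _ ℤ) i j : ℤ) : ℂ) *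
        (fun i => ((w : _ → ℝ) i : ℂ)) j).re)

/-- `GenThree[G] W`: no non-zero lattice vector is orthogonal to `W` — the shape of
`IsGenericThreeSpace`. -/
local notation3 (prettyPrint := false) "GenThree[" G "](" W ")" =>
  (∀ v : _ → ℤ, (∀ w ∈ (W : Submodule ℝ (_ → ℝ)),
      ∑ i, ∑ j, (fun i => ((v i : ℤ) : ℂ)) i * (((G : Matrix _ _ ℤ) i j : ℤ) : ℂ) *
        (fun i => ((w : _ → ℝ) i : ℂ)) j = 0) → v = 0)

/-- `x ∈ TwLine[G] W`: `x` is a period point with `Re x, Im x ∈ W` — the shape of `k3TwistorLine`. -/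
local notation3 (prettyPrint := false) "TwLine[" G "](" W ")" =>
  {x : _ → ℂ | (CF[G](x, x) = 0 ∧ 0 < (CF[G](star x, x)).re) ∧
    (fun i => (x i).re) ∈ (W : Submodule ℝ (_ → ℝ)) ∧ (fun i => (x i).im) ∈ (W : Submodule ℝ (_ → ℝ))}

/-- `Step[G] x y`: `x` and `y` lie on a common GENERIC twistor line — the shape of
`OnCommonGenericTwistorLine`. -/
local notation3 (prettyPrint := false) "Step[" G "]" =>
  fun (x y : _ → ℂ) => ∃ W : Submodule ℝ (_ → ℝ),
    PosThree[G](W) ∧ GenThree[G](W) ∧ x ∈ TwLine[G](W) ∧ y ∈ TwLine[G](W)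

/-- **Positive three-spaces from positive triples**: the span of a triple on which the real form is
positive definite is a positive three-space. [cite: Huybrechts2016K3, Ch. 7 §3.1] -/
theorem lattice_posThree_span_of_posFamily (G : Matrix ι ι ℤ) {t : Fin 3 → ι → ℝ}
    (ht : ∀ c : Fin 3 → ℝ, c ≠ 0 → 0 < RB[G] (∑ i, c i • t i) (∑ i, c i • t i)) :
    PosThree[G](Submodule.span ℝ (Set.range t)) := by
  refine ⟨twistorV_finrank_span _ ht, fun w hw hw0 => ?_⟩
  rw [latticeCF_ofReal_re]
  exact twistorV_pos_of_mem_span _ ht hw hw0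

/-- **Generic three-spaces from generic vectors**: a subspace containing a vector `g` with
`g^⊥ ∩ Λ = 0` is generic. [cite: Huybrechts2016K3, Ch. 7 §3.1] -/
theorem lattice_genThree_of_generic_mem (G : Matrix ι ι ℤ) {W : Submodule ℝ (ι → ℝ)}
    {g : ι → ℝ} (hgW : g ∈ W) (hg : ∀ v : ι → ℤ, RB[G] (fun i => (v i : ℝ)) g = 0 → v = 0) :
    GenThree[G](W) := by
  intro v hv
  apply hg
  have h := hv g hgW
  rw [latticeCF_intCast_ofReal] at h
  exact_mod_cast h

/-- **A generic positive three-space exists** as soon as the lattice is non-degenerate and has a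
positive triple `t`: take `u = t₀`, positive `m ∈ ⟨t⟩ ∩ u^⊥`, positive `m₂ ∈ ⟨t⟩ ∩ ⟨u, m⟩^⊥`,
and the generic perturbation `u + ε g₀` of `u` relative to the positive plane `⟨m, m₂⟩`.
[cite: Huybrechts2016K3, Ch. 7 §3.1] -/
theorem exists_lattice_generic_posFamily (G : Matrix ι ι ℤ) (hG : ∀ i j, G i j = G j i)
    (hdet : G.det ≠ 0) {t : Fin 3 → ι → ℝ}
    (ht : ∀ c : Fin 3 → ℝ, c ≠ 0 → 0 < RB[G] (∑ i, c i • t i) (∑ i, c i • t i)) :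
    ∃ t' : Fin 3 → ι → ℝ,
      (∀ c : Fin 3 → ℝ, c ≠ 0 → 0 < RB[G] (∑ i, c i • t' i) (∑ i, c i • t' i)) ∧
        GenThree[G](Submodule.span ℝ (Set.range t')) := by
  have hBs : ∀ u w, RB[G] u w = RB[G] w u := latticeRB_comm G hG
  obtain ⟨g, hg⟩ := exists_lattice_genericVector G hdet
  set u : ι → ℝ := t 0 with hu_def
  have hu : 0 < RB[G] u u := by
    have h := ht ![1, 0, 0] (fun h0 => by simpa using congrFun h0 0)
    have hsum : ∑ i, (![(1 : ℝ), 0, 0] i) • t i = u := by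
      simp [Fin.sum_univ_three, hu_def]
    rwa [hsum] at h
  obtain ⟨m, -, hmu, -, hm⟩ := twistorV_exists_orthogonal_mem_span (RB[G]) t ht u u
  obtain ⟨m₂, -, hm₂u, hm₂m, hm₂⟩ := twistorV_exists_orthogonal_mem_span (RB[G]) t ht u m
  have hum : RB[G] u m = 0 := by rw [hBs, hmu]
  have hum₂ : RB[G] u m₂ = 0 := by rw [hBs, hm₂u]
  have hmm₂ : RB[G] m m₂ = 0 := by rw [hBs, hm₂m]
  obtain ⟨ε, hgen, hpos⟩ := twistorV_exists_generic_perturbation (RB[G]) hBs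
    (fun v : ι → ℤ => fun i => (v i : ℝ)) (fun v => v = 0)
    (a := m) (b := m₂) (n := u) (g := g) hmm₂ hm hm₂ hum hum₂ hu hg
  refine ⟨![m, m₂, u + ε • g], hpos, ?_⟩
  exact lattice_genThree_of_generic_mem G (Submodule.subset_span ⟨2, rfl⟩) hgen

/-! ### The chain of three generic twistor lines from a point of `D` into `T_{V⋆}`
(Huybrechts Ch. 7 §3.1, proof of Prop. 3.2) -/

/-- **Three generic twistor lines from any period point into a fixed twistor line**: let
`V = ⟨t₀, t₁, t₂⟩` be a positive three-space. Every period point `x`, `P(x) = ⟨a, b⟩`, is joined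
to a point `z` of the twistor line `T_V` by the chain `T₁ = ⟨a, b, c⟩ ⊃ ⟨a, b⟩, ⟨a, c⟩`,
`T₂ = ⟨a, c, b'⟩ ⊃ ⟨a, c⟩, ⟨c, b'⟩`, `T₃ = ⟨c, b', a'⟩ ⊃ ⟨c, b'⟩, ⟨b', a'⟩`, with `c = n + ε g₀`
generic, `b' ∈ V ∩ ⟨a, c⟩^⊥`, `a' ∈ V ∩ ⟨c, b'⟩^⊥`. [cite: Huybrechts2016K3, Ch. 7 §3.1 (proof of Prop. 3.2)] -/
theorem exists_lattice_twistorChain_to (G : Matrix ι ι ℤ) (hG : ∀ i j, G i j = G j i)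
    (hdet : G.det ≠ 0) (t : Fin 3 → ι → ℝ)
    (ht : ∀ c : Fin 3 → ℝ, c ≠ 0 → 0 < RB[G] (∑ i, c i • t i) (∑ i, c i • t i))
    {x : ι → ℂ} (hx : CF[G](x, x) = 0 ∧ 0 < (CF[G](star x, x)).re) :
    ∃ z ∈ TwLine[G](Submodule.span ℝ (Set.range t)), Relation.ReflTransGen (Step[G]) x z := by
  have hBs : ∀ u w, RB[G] u w = RB[G] w u := latticeRB_comm G hG
  obtain ⟨g, hg⟩ := exists_lattice_genericVector G hdet
  obtain ⟨hab, haabb, ha⟩ := (latticePeriod_iff_re_im G hG x).1 hx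
  set a : ι → ℝ := fun i => (x i).re with ha_def
  set b : ι → ℝ := fun i => (x i).im with hb_def
  have hb : 0 < RB[G] b b := haabb ▸ ha
  -- `n ∈ V ∩ ⟨a, b⟩^⊥` positive, and the generic `n' = n + ε g₀` with `⟨a, b, n'⟩` positive
  obtain ⟨n, -, hna, hnb, hn⟩ := twistorV_exists_orthogonal_mem_span (RB[G]) t ht a b
  obtain ⟨ε, hgen, hpos₁⟩ := twistorV_exists_generic_perturbation (RB[G]) hBs
    (fun v : ι → ℤ => fun i => (v i : ℝ)) (fun v => v = 0) hab ha hb hna hnb hn hg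
  set n' := n + ε • g with hn'
  -- `T₁ = ⟨a, b, n'⟩`
  have hW₁pos := lattice_posThree_span_of_posFamily G hpos₁
  have haW₁ : a ∈ Submodule.span ℝ (Set.range ![a, b, n']) := Submodule.subset_span ⟨0, rfl⟩
  have hbW₁ : b ∈ Submodule.span ℝ (Set.range ![a, b, n']) := Submodule.subset_span ⟨1, rfl⟩
  have hn'W₁ : n' ∈ Submodule.span ℝ (Set.range ![a, b, n']) := Submodule.subset_span ⟨2, rfl⟩
  have hW₁gen := lattice_genThree_of_generic_mem G hn'W₁ hgen
  -- `ñ`: the component of `n'` orthogonal to `a`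
  set l := RB[G] n' a / RB[G] a a with hl
  set ñ := n' - l • a with hñ
  have hña : RB[G] ñ a = 0 := by
    rw [hñ, LinearMap.BilinForm.sub_left, LinearMap.BilinForm.smul_left, hl,
      div_mul_cancel₀ _ ha.ne', sub_self]
  have haña : RB[G] a ñ = 0 := by rw [hBs, hña]
  have hñW₁ : ñ ∈ Submodule.span ℝ (Set.range ![a, b, n']) :=
    Submodule.sub_mem _ hn'W₁ (Submodule.smul_mem _ _ haW₁)
  have hñpos : 0 < RB[G] ñ ñ := by
    have h := hpos₁ ![-l, 0, 1] (fun h0 => by simpa using congrFun h0 2)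
    have hsum : ∑ i, ![-l, 0, 1] i • ![a, b, n'] i = ñ := by
      simp only [Fin.sum_univ_three, Matrix.cons_val_zero, Matrix.cons_val_one,
        Matrix.cons_val_two, Matrix.head_cons, Matrix.tail_cons, hñ]
      module
    rwa [hsum] at h
  have hn'pos : 0 < RB[G] n' n' := by
    have h := hpos₁ ![0, 0, 1] (fun h0 => by simpa using congrFun h0 2)
    have hsum : ∑ i, ![(0 : ℝ), 0, 1] i • ![a, b, n'] i = n' := by
      simp only [Fin.sum_univ_three, Matrix.cons_val_zero, Matrix.cons_val_one,
        Matrix.cons_val_two, Matrix.head_cons, Matrix.tail_cons]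
      module
    rwa [hsum] at h
  have hn'eq : n' = ñ + l • a := by rw [hñ]; module
  -- the point `z₁` with `P(z₁) = ⟨a, ñ⟩ = ⟨a, n'⟩`, on `T₁` together with `x`
  obtain ⟨s₁, hz₁⟩ := exists_latticePeriod_re_im G hG haña ha hñpos
  have hxmem : x ∈ TwLine[G](Submodule.span ℝ (Set.range ![a, b, n'])) := ⟨hx, haW₁, hbW₁⟩
  have hxz₁ : (Step[G]) x (fun i => (⟨a i, (s₁ • ñ) i⟩ : ℂ)) :=
    ⟨_, hW₁pos, hW₁gen, hxmem, ⟨hz₁, haW₁, Submodule.smul_mem _ _ hñW₁⟩⟩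
  -- `b' = m ∈ V ∩ ⟨a, ñ⟩^⊥` positive; `T₂ = ⟨a, ñ, m⟩ ∋ n'`
  obtain ⟨m, hmV, hma, hmñ, hm⟩ := twistorV_exists_orthogonal_mem_span (RB[G]) t ht a ñ
  have ham : RB[G] a m = 0 := by rw [hBs, hma]
  have hñm : RB[G] ñ m = 0 := by rw [hBs, hmñ]
  have hpos₂ := twistorV_posFamily_of_orthogonal (RB[G]) hBs haña ham hñm ha hñpos hm
  have hW₂pos := lattice_posThree_span_of_posFamily G hpos₂
  have haW₂ : a ∈ Submodule.span ℝ (Set.range ![a, ñ, m]) := Submodule.subset_span ⟨0, rfl⟩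
  have hñW₂ : ñ ∈ Submodule.span ℝ (Set.range ![a, ñ, m]) := Submodule.subset_span ⟨1, rfl⟩
  have hmW₂ : m ∈ Submodule.span ℝ (Set.range ![a, ñ, m]) := Submodule.subset_span ⟨2, rfl⟩
  have hn'W₂ : n' ∈ Submodule.span ℝ (Set.range ![a, ñ, m]) := by
    rw [hn'eq]
    exact Submodule.add_mem _ hñW₂ (Submodule.smul_mem _ _ haW₂)
  have hW₂gen := lattice_genThree_of_generic_mem G hn'W₂ hgen
  have hn'm : RB[G] n' m = 0 := by
    rw [hn'eq, LinearMap.BilinForm.add_left, LinearMap.BilinForm.smul_left, hñm, ham, mul_zero,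
      add_zero]
  -- the point `z₂` with `P(z₂) = ⟨n', m⟩`, on `T₂` together with `z₁`
  obtain ⟨s₂, hz₂⟩ := exists_latticePeriod_re_im G hG hn'm hn'pos hm
  have hz₁z₂ : (Step[G]) (fun i => (⟨a i, (s₁ • ñ) i⟩ : ℂ)) (fun i => (⟨n' i, (s₂ • m) i⟩ : ℂ)) :=
    ⟨_, hW₂pos, hW₂gen, ⟨hz₁, haW₂, Submodule.smul_mem _ _ hñW₂⟩,
      ⟨hz₂, hn'W₂, Submodule.smul_mem _ _ hmW₂⟩⟩
  -- `a' = m₂ ∈ V ∩ ⟨n', m⟩^⊥` positive; `T₃ = ⟨n', m, m₂⟩ ∋ n'`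
  obtain ⟨m₂, hm₂V, hm₂n', hm₂m, hm₂⟩ := twistorV_exists_orthogonal_mem_span (RB[G]) t ht n' m
  have hn'm₂ : RB[G] n' m₂ = 0 := by rw [hBs, hm₂n']
  have hmm₂ : RB[G] m m₂ = 0 := by rw [hBs, hm₂m]
  have hpos₃ := twistorV_posFamily_of_orthogonal (RB[G]) hBs hn'm hn'm₂ hmm₂ hn'pos hm hm₂
  have hW₃pos := lattice_posThree_span_of_posFamily G hpos₃
  have hn'W₃ : n' ∈ Submodule.span ℝ (Set.range ![n', m, m₂]) := Submodule.subset_span ⟨0, rfl⟩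
  have hmW₃ : m ∈ Submodule.span ℝ (Set.range ![n', m, m₂]) := Submodule.subset_span ⟨1, rfl⟩
  have hm₂W₃ : m₂ ∈ Submodule.span ℝ (Set.range ![n', m, m₂]) := Submodule.subset_span ⟨2, rfl⟩
  have hW₃gen := lattice_genThree_of_generic_mem G hn'W₃ hgen
  -- the point `z₃` with `P(z₃) = ⟨m, m₂⟩ ⊂ V`, on `T₃` together with `z₂`
  obtain ⟨s₃, hz₃⟩ := exists_latticePeriod_re_im G hG hmm₂ hm hm₂
  have hz₂z₃ : (Step[G]) (fun i => (⟨n' i, (s₂ • m) i⟩ : ℂ)) (fun i => (⟨m i, (s₃ • m₂) i⟩ : ℂ)) :=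
    ⟨_, hW₃pos, hW₃gen, ⟨hz₂, hn'W₃, Submodule.smul_mem _ _ hmW₃⟩,
      ⟨hz₃, hmW₃, Submodule.smul_mem _ _ hm₂W₃⟩⟩
  refine ⟨fun i => (⟨m i, (s₃ • m₂) i⟩ : ℂ), ⟨hz₃, hmV, Submodule.smul_mem _ _ hm₂V⟩, ?_⟩
  exact ((Relation.ReflTransGen.single hxz₁).tail hz₁z₂).tail hz₂z₃

/-! ### Huybrechts Ch. 7 Prop. 3.2 for an arbitrary non-degenerate integral lattice with a
positive triple -/

/-- **Twistor-line connectivity of the period domain** (Huybrechts, *Lectures on K3 Surfaces*,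
Ch. 7 Prop. 3.2: "Any two points `x, y ∈ D` are equivalent") for the integral lattice `ℤ^ι` with
symmetric Gram matrix `G`, `det G ≠ 0`, possessing a positive triple: any two period vectors are
joined by a finite chain of GENERIC twistor lines. Proof: both `x` and `y` are chained by three
generic twistor lines into the generic twistor line `T_{V⋆}` (`exists_lattice_twistorChain_to`,
`exists_lattice_generic_posFamily`), whose points are pairwise equivalent in one step; chains
reverse by symmetry of the step. [cite: Huybrechts2016K3, Ch. 7 §3.1 Prop. 3.2] -/
theorem lattice_periodDomain_twistorConnected (G : Matrix ι ι ℤ) (hG : ∀ i j, G i j = G j i)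
    (hdet : G.det ≠ 0)
    (ht : ∃ t : Fin 3 → ι → ℝ, ∀ c : Fin 3 → ℝ, c ≠ 0 → 0 < RB[G] (∑ i, c i • t i) (∑ i, c i • t i))
    {x y : ι → ℂ} (hx : CF[G](x, x) = 0 ∧ 0 < (CF[G](star x, x)).re)
    (hy : CF[G](y, y) = 0 ∧ 0 < (CF[G](star y, y)).re) :
    Relation.ReflTransGen (Step[G]) x y := by
  obtain ⟨t₀, ht₀⟩ := ht
  obtain ⟨t, ht, htg⟩ := exists_lattice_generic_posFamily G hG hdet ht₀
  obtain ⟨z, hz, hxz⟩ := exists_lattice_twistorChain_to G hG hdet t ht hx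
  obtain ⟨z', hz', hyz'⟩ := exists_lattice_twistorChain_to G hG hdet t ht hy
  have hzz' : (Step[G]) z z' := ⟨_, lattice_posThree_span_of_posFamily G ht, htg, hz, hz'⟩
  have hstep_symm : ∀ {p q : ι → ℂ}, (Step[G]) p q → (Step[G]) q p := by
    rintro p q ⟨W, hW, hg, hp, hq⟩
    exact ⟨W, hW, hg, hq, hp⟩
  have hsymm : ∀ {p q : ι → ℂ}, Relation.ReflTransGen (Step[G]) p q →
      Relation.ReflTransGen (Step[G]) q p := by
    intro p q h
    induction h with
    | refl => exact Relation.ReflTransGen.refl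
    | tail _ hbc ih => exact Relation.ReflTransGen.head (hstep_symm hbc) ih
  exact (hxz.tail hzz').trans (hsymm hyz')

/-- **Registered sub-goal `latticeTwistorConnected`** (closed form of
`lattice_periodDomain_twistorConnected`, everything spelled out): Huybrechts Ch. 7 Prop. 3.2 for
every non-degenerate symmetric integral lattice with a positive triple.
[cite: Huybrechts2016K3, Ch. 7 §3.1 Prop. 3.2] -/
theorem latticeTwistorConnected : ∀ {ι : Type} [Fintype ι] [DecidableEq ι] (G : Matrix ι ι ℤ), (∀ i j, G i j = G j i) → G.det ≠ 0 → (∃ t : Fin 3 → ι → ℝ, ∀ c : Fin 3 → ℝ, c ≠ 0 → 0 < Matrix.toBilin' (Matrix.map G (Int.cast : ℤ → ℝ)) (∑ i, c i • t i) (∑ i, c i • t i)) → ∀ x y : ι → ℂ, (∑ i, ∑ j, x i * ((G i j : ℤ) : ℂ) * x j = 0 ∧ 0 < (∑ i, ∑ j, (star x) i * ((G i j : ℤ) : ℂ) * x j).re) → (∑ i, ∑ j, y i * ((G i j : ℤ) : ℂ) * y j = 0 ∧ 0 < (∑ i, ∑ j, (star y) i * ((G i j : ℤ) : ℂ) * y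 j).re) → Relation.ReflTransGen (fun x y : ι → ℂ => ∃ W : Submodule ℝ (ι → ℝ), (Module.finrank ℝ W = 3 ∧ ∀ w ∈ W, w ≠ 0 → 0 < (∑ i, ∑ j, (fun i => ((w : ι → ℝ) i : ℂ)) i * ((G i j : ℤ) : ℂ) * (fun i => ((w : ι → ℝ) i : ℂ)) j).re) ∧ (∀ v : ι → ℤ, (∀ w ∈ W, ∑ i, ∑ j, (fun i => ((v i : ℤ) : ℂ)) i * ((G i j : ℤ) : ℂ) * (fun i => ((w : ι → ℝ) i : ℂ)) j = 0) → v = 0) ∧ x ∈ {x : ι → ℂ | (∑ i, ∑ j, x i * ((G i j : ℤ) : ℂ) * x j = 0 ∧ 0 < (∑ i, ∑ j, (star x) i * ((G i j : ℤ) : ℂ) * x j).re) ∧ (fun i => (x i).re) ∈ W ∧ (fun i => (x i).im) ∈ W} ∧ y ∈ {x : ι → ℂ | (∑ i, ∑ j, x i * ((G i j : ℤ) : ℂ) * x j = 0 ∧ 0 < (∑ i, ∑ j, (star x) i * ((G i j : ℤ) : ℂ) * x j).re) ∧ (fun i => (x i).re) ∈ W ∧ (fun i => (x i).im) ∈ W})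 x y :=
  fun G hG hdet ht _ _ hx hy => lattice_periodDomain_twistorConnected G hG hdet ht hx hy

end Summit.HodgeConjecture.HodgeConjecture.Theorems.TwinTwistorTransport.MukaiLift

end
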